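import Summits.BirchSwinnertonDyer.BirchSwinnertonDyer.Theorems.ConjSpanGenAllLevelsDecomposition
import HarnessLib

/-!
# THEOREM B: the cyclotomic winding classes span `pr Γ_H(N)` for EVERY level — `ConjSpanGen N p` for all
# `N ≥ 1` and all primes `p ∤ N` — PART 3/3: THEOREM B kernel part (orbit trick assembled), the transpose bridge, and THEOREM B from (V) [Vaserstein] / from (L) Morris 2007 Thm. 6.1 (2) + (C) Serre 1970 §2.6 Cor. 3

Summit `BirchSwinnertonDyer`, `Theorems/`; namespace `Summit.BirchSwinnertonDyer.BirchSwinnertonDyer.Theorems.ConjSpanGenAllLevels`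
(shared by the three parts, so every FQN is the author's). PROVENANCE, CREDIT, HONEST FRAMING AND REFERENCES:
see the module docstring of PART 1/3, `ConjSpanGenAllLevelsDefs.lean` — the mathematics (MEMO-an §13
«THEOREM B», cell bsd-f3-mu) and the Lean text are seat bsd-f3-mu-an g4/g5's `pub/bsd-f3-mu/an/g5/TheoremB.lean`
(sha16 583a2ab32092eff9, audited: bsd-f3-mu ref1/ref2, bsd-print-x8 plan g5, ref g5 R-74/R-90/R-92), filed
VERBATIM by cell bsd-print-x8's typer ty2 g6 (`HOME/ty2/ConjSpanGenAllLevels.lean.txt` 323d4d2dc7a5d402, farm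
rc 0 · 0 sorry) with the last section (L)+(C) ⟹ (V) appended, and SPLIT into three files ≤ 400 lines by cell
bsd-print-x8's prover p4 g2 because the gate refuses Theorems files from literature-prover seats (D-0016) and
proof files over 400 lines (lint.statement-form); bodies VERBATIM, docstrings added to helper lemmas
(lint.docstring). ROUTE-INDEPENDENT support (Literature + Mathlib imports only at the root); bears on route
`PrintX8` crux `MuBoundSmallImageX8` (stmt-BirchSwinnertonDyer-20622) through the VS road and on the sister
route `PrintX8VS` crux `ConjSpanGenAll` (stmt-BirchSwinnertonDyer-21705). beyond-print theorem: YES-candidate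
(director W-36 sense) for the whole; PARTITION currency 0 by itself. BSD is not advanced by this file alone.

References: [Morris2007] Thm. 6.1 (2); [SerreSL2Congruence1970] §2.6 Thm. 2 (b), Cor. 1, Cor. 3;
[Vaserstein1972SL2] Lemma 1, Theorem; [Manin1972] Prop. 1.4, Thm. 1.9; [Sun2007] §4 Conj. 8 (NOT proved here).
-/

set_option linter.dupNamespace false

namespace Summit.BirchSwinnertonDyer.BirchSwinnertonDyer.Theorems.ConjSpanGenAllLevels

noncomputable section

open scoped MatrixGroups
open CongruenceSubgroup
open Literature.NumberTheory.EllipticCurves.Rank1Residual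

variable {p N : ℕ}

/-! ### THEOREM B, kernel part I -/

/-- **The orbit trick, concrete form:** `(E)`, `Δ = Γ₀(N)B⁺` and `Δ = Γ₀(N)B⁻_N` imply `ConjSpanGen N p`. -/
theorem conjSpanGen_of_decomp (hp : p.Prime) (hE : GammaHInTriangularSubgroup p N)
    (h3 : DeltaEqGamma0MulUpper p N) (h3' : DeltaEqGamma0MulLower p N) : ConjSpanGen N p := by
  intro γ hγH
  have hx : iota p (γ : SL(2, ℤ)) ∈
      Subgroup.closure ((upperB p : Set SL(2, Away p)) ∪ (lowerP p N : Set _)) := by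
    have hγ0 : (N : ℤ) ∣ (γ : SL(2, ℤ)) 1 0 :=
      (CharP.intCast_eq_zero_iff (ZMod N) N _).1 ((Gamma0_mem).1 γ.2)
    exact triangularSubgroup_le (hE γ hγ0 hγH)
  have H3 : ∀ ⦃d⦄, d ∈ Delta p N → ∃ γ' ∈ gamma0Image p N, ∃ b ∈ upperB p, d = γ' * b := by
    intro d hd
    obtain ⟨γ', hγ', b, hb, h⟩ := h3 d hd
    exact ⟨iota p γ', ⟨γ', hγ', rfl⟩, b, hb, h⟩
  have H3' : ∀ ⦃d⦄, d ∈ Delta p N → ∃ γ' ∈ gamma0Image p N, ∃ q ∈ lowerP p N, d = γ' * q := by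
    intro d hd
    obtain ⟨γ', hγ', q, hq, h⟩ := h3' d hd
    exact ⟨iota p γ', ⟨γ', hγ', rfl⟩, q, hq, h⟩
  have hmem : iota p (γ : SL(2, ℤ)) ∈ spanImage p N :=
    OrbitTrick.mem_of_mem_closure upperB_le_Delta lowerP_le_Delta gamma0Image_le_Delta
      (h1_concrete hp.ne_zero) (h2_concrete hp) H3 H3' ⟨γ, γ.2, rfl⟩ hx
  obtain ⟨δ, ⟨ε, hε, rfl⟩, hδ⟩ := hmem
  have hεγ : ε = γ := Subtype.ext (iota_injective hp.ne_zero hδ)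
  rw [← hεγ]
  exact hε

/-- **THEOREM B, kernel part I (all levels):** `(E)_all ∧ (h3)_all ∧ (h3')_all → ConjSpanGenAll`. -/
theorem conjSpanGenAll_of (hE : GammaHInTriangularSubgroupAll)
    (h3 : ∀ p N : ℕ, p.Prime → ¬ p ∣ N → DeltaEqGamma0MulUpper p N)
    (h3' : ∀ p N : ℕ, p.Prime → ¬ p ∣ N → DeltaEqGamma0MulLower p N) : ConjSpanGenAll := by
  intro N p hp hpN
  have hN : 0 < N := Nat.pos_of_ne_zero (by rintro rfl; exact hpN (dvd_zero p))
  exact conjSpanGen_of_decomp hp (hE p N hp hN hpN) (h3 p N hp hpN) (h3' p N hp hpN)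

/-- **The orbit trick from (V):** `G(A,NA) ≤ E(A,NA)`, `Δ = Γ₀(N)B⁺`, `Δ = Γ₀(N)B⁻_N` imply `ConjSpanGen N p`. -/
theorem conjSpanGen_of_relGLeRelE (hp : p.Prime) (hV : RelGLeRelE p N)
    (h3 : DeltaEqGamma0MulUpper p N) (h3' : DeltaEqGamma0MulLower p N) : ConjSpanGen N p := by
  intro γ hγH
  have hx := iota_mem_closure_of_relGLeRelE hp hV γ hγH
  have H3 : ∀ ⦃d⦄, d ∈ Delta p N → ∃ γ' ∈ gamma0Image p N, ∃ b ∈ upperB p, d = γ' * b := by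
    intro d hd
    obtain ⟨γ', hγ', b, hb, h⟩ := h3 d hd
    exact ⟨iota p γ', ⟨γ', hγ', rfl⟩, b, hb, h⟩
  have H3' : ∀ ⦃d⦄, d ∈ Delta p N → ∃ γ' ∈ gamma0Image p N, ∃ q ∈ lowerP p N, d = γ' * q := by
    intro d hd
    obtain ⟨γ', hγ', q, hq, h⟩ := h3' d hd
    exact ⟨iota p γ', ⟨γ', hγ', rfl⟩, q, hq, h⟩
  have hmem : iota p (γ : SL(2, ℤ)) ∈ spanImage p N :=
    OrbitTrick.mem_of_mem_closure upperB_le_Delta lowerP_le_Delta gamma0Image_le_Delta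
      (h1_concrete hp.ne_zero) (h2_concrete hp) H3 H3' ⟨γ, γ.2, rfl⟩ hx
  obtain ⟨δ, ⟨ε, hε, rfl⟩, hδ⟩ := hmem
  have hεγ : ε = γ := Subtype.ext (iota_injective hp.ne_zero hδ)
  rw [← hεγ]
  exact hε

/-- **THEOREM B from (V) (all levels):** `(V)_all ∧ (h3)_all ∧ (h3')_all → ConjSpanGenAll`. -/
theorem conjSpanGenAll_of_relGLeRelE (hV : ∀ p N : ℕ, p.Prime → 0 < N → ¬ p ∣ N → RelGLeRelE p N)
    (h3 : ∀ p N : ℕ, p.Prime → ¬ p ∣ N → DeltaEqGamma0MulUpper p N)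
    (h3' : ∀ p N : ℕ, p.Prime → ¬ p ∣ N → DeltaEqGamma0MulLower p N) : ConjSpanGenAll := by
  intro N p hp hpN
  have hN : 0 < N := Nat.pos_of_ne_zero (by rintro rfl; exact hpN (dvd_zero p))
  exact conjSpanGen_of_relGLeRelE hp (hV p N hp hN hpN) (h3 p N hp hpN) (h3' p N hp hpN)

/-- **THEOREM B = AN-10 reduced to (V) alone:** Vaserstein's `G(A,NA) ≤ E(A,NA)` at `A = ℤ[1/p]` for all primes
`p ∤ N` implies `ConjSpanGenAll` — everything else (orbit trick, `Δ = Γ₀(N)B⁺ = Γ₀(N)B⁻_N`) is proved above. -/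
theorem conjSpanGenAll_of_relGLeRelE_all
    (hV : ∀ p N : ℕ, p.Prime → 0 < N → ¬ p ∣ N → RelGLeRelE p N) : ConjSpanGenAll :=
  conjSpanGenAll_of_relGLeRelE hV (fun _ _ hp hpN => deltaEqGamma0MulUpper hp hpN)
    (fun _ _ hp hpN => deltaEqGamma0MulLower hp hpN)

/-- Single-level form: `(V)` at `(p, N)` with `p` prime, `p ∤ N` implies `ConjSpanGen N p`. -/
theorem conjSpanGen_of_relGLeRelE' (hp : p.Prime) (hpN : ¬ p ∣ N) (hV : RelGLeRelE p N) : ConjSpanGen N p :=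
  conjSpanGen_of_relGLeRelE hp hV (deltaEqGamma0MulUpper hp hpN) (deltaEqGamma0MulLower hp hpN)

/-- The same from g4's **(E)** `GammaHInTriangularSubgroup` (derivable from (L) Morris 2007 Thm 6.1(2) + (C)
Serre 1970 via MEMO-an §13.2 (iv)). -/
theorem conjSpanGenAll_of_gammaHInTriangularSubgroupAll (hE : GammaHInTriangularSubgroupAll) :
    ConjSpanGenAll :=
  conjSpanGenAll_of hE (fun _ _ hp hpN => deltaEqGamma0MulUpper hp hpN)
    (fun _ _ hp hpN => deltaEqGamma0MulLower hp hpN)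

/-! ### Transpose bridge: the tree's shape `G((N), A) ≤ E((N), A)` gives `RelGLeRelE` -/

section TransposeBridge

variable {R : Type*} [CommRing R]

/-- Entries of the transpose. [folklore] -/
theorem transpose_apply (M : SL(2, R)) (i j : Fin 2) :
    (Matrix.SpecialLinearGroup.transpose M) i j = M j i := rfl

/-- Transpose reverses products in `SL₂`. [folklore] -/
theorem transpose_mul (M M' : SL(2, R)) :
    Matrix.SpecialLinearGroup.transpose (M * M') =
      Matrix.SpecialLinearGroup.transpose M' * Matrix.SpecialLinearGroup.transpose M := by
  ext i j
  simp only [Matrix.SpecialLinearGroup.coe_transpose, Matrix.SpecialLinearGroup.coe_mul,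
    Matrix.transpose_mul]

/-- Transpose of `1`. [folklore] -/
theorem transpose_one' : Matrix.SpecialLinearGroup.transpose (1 : SL(2, R)) = 1 :=
  Subtype.ext Matrix.transpose_one

/-- Transpose commutes with inversion in `SL₂`. [folklore] -/
theorem transpose_inv (M : SL(2, R)) :
    Matrix.SpecialLinearGroup.transpose M⁻¹ = (Matrix.SpecialLinearGroup.transpose M)⁻¹ := by
  apply eq_inv_of_mul_eq_one_left
  rw [← transpose_mul, mul_inv_cancel, transpose_one']

/-- Transpose is an involution. [folklore] -/
theorem transpose_transpose (M : SL(2, R)) :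
    Matrix.SpecialLinearGroup.transpose (Matrix.SpecialLinearGroup.transpose M) = M := by
  ext i j; rfl

open Literature.NumberTheory.Automorphic.SL2Rel in
/-- Transpose swaps the two ideals of `relG`. [folklore] -/
theorem transpose_mem_relG {I₁ I₂ : Ideal R} {M : SL(2, R)} (hM : M ∈ relG I₁ I₂) :
    Matrix.SpecialLinearGroup.transpose M ∈ relG I₂ I₁ := by
  rw [mem_relG] at hM ⊢
  obtain ⟨h01, h10, h00, h11⟩ := hM
  refine ⟨h10, h01, ?_, ?_⟩
  · show M 0 0 - 1 ∈ I₂ * I₁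
    rw [mul_comm]; exact h00
  · show M 1 1 - 1 ∈ I₂ * I₁
    rw [mul_comm]; exact h11

open Literature.NumberTheory.Automorphic.SL2Rel in
/-- Transpose swaps the two ideals of `relE`. [folklore] -/
theorem transpose_mem_relE {I₁ I₂ : Ideal R} {M : SL(2, R)} (hM : M ∈ relE I₁ I₂) :
    Matrix.SpecialLinearGroup.transpose M ∈ relE I₂ I₁ := by
  refine Subgroup.closure_induction
    (p := fun M _ => Matrix.SpecialLinearGroup.transpose M ∈ relE I₂ I₁) ?_ ?_ ?_ ?_ hM
  · rintro _ (⟨x, hx, rfl⟩ | ⟨y, hy, rfl⟩)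
    · have : Matrix.SpecialLinearGroup.transpose (e12 x) = e21 x := by
        ext i j; fin_cases i <;> fin_cases j <;> rfl
      rw [this]; exact e21_mem_relE hx
    · have : Matrix.SpecialLinearGroup.transpose (e21 y) = e12 y := by
        ext i j; fin_cases i <;> fin_cases j <;> rfl
      rw [this]; exact e12_mem_relE hy
  · rw [transpose_one']; exact one_mem _
  · intro M M' _ _ hM hM'
    rw [transpose_mul]; exact mul_mem hM' hM
  · intro M _ hM
    rw [transpose_inv]; exact inv_mem hM

open Literature.NumberTheory.Automorphic.SL2Rel in
/-- `G(I, R) ≤ E(I, R)` (first-column shape, as in the tree's CSP reduction) implies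
`G(R, I) ≤ E(R, I)` (second-column shape used by the orbit trick), by transposition. -/
theorem relG_top_le_relE_top_of_relG_le_relE (I : Ideal R) (h : relG I ⊤ ≤ relE I ⊤) :
    relG ⊤ I ≤ relE ⊤ I := by
  intro M hM
  have h2 := transpose_mem_relE (h (transpose_mem_relG hM))
  rwa [transpose_transpose] at h2

end TransposeBridge

/-- **TURNKEY.** THEOREM B (`ConjSpanGenAll`, all primes `p` and all levels `N` with `p ∤ N`) from the
single cite-only input "`G(e·ℤ[1/m], ℤ[1/m]) ≤ E(e·ℤ[1/m], ℤ[1/m])` for `m ≥ 2`, `e ≠ 0`"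
(Vaserstein 1972, Theorem + Bass–Milnor–Serre 1967, Ch. I Thm. 3.6, at the Dedekind ring of arithmetic
type `A = ℤ[1/m]`, which has a real place and the unit `m` of infinite order) — stated in EXACTLY the
hypothesis shape of the tree's `congruenceSubgroupProperty_away_of_relG_le_relE`
(`Literature/NumberTheory/Automorphic/CongruenceSubgroupPropertySL2Away.lean`). -/
theorem conjSpanGenAll_of_vaserstein_away
    (h : ∀ (m : ℕ), 2 ≤ m → ∀ e : ℕ, e ≠ 0 →
      Literature.NumberTheory.Automorphic.SL2Rel.relG (Ideal.span {(e : Localization.Away (m : ℤ))}) ⊤ ≤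
        Literature.NumberTheory.Automorphic.SL2Rel.relE (Ideal.span {(e : Localization.Away (m : ℤ))})
          (⊤ : Ideal (Localization.Away (m : ℤ)))) :
    ConjSpanGenAll :=
  conjSpanGenAll_of_relGLeRelE_all fun p N hp hN _ =>
    relG_top_le_relE_top_of_relG_le_relE _ (h p hp.two_le N hN.ne')

/-! ## THEOREM B from the two printed inputs (L) + (C) (cell bsd-print-x8, seat ty2 g6) -/

section FromMorrisSerre

open Literature.NumberTheory.Automorphic Literature.GroupTheory.ArithmeticGroups

/-- `(V)` at `(p, N)` — `RelGLeRelE p N`, Vaserstein's `G(A, NA) ≤ E(A, NA)` over `A = ℤ[1/p]` — from the two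
cite-only printed inputs (L) [Morris2007, Thm. 6.1 (2)] and (C) [SerreSL2Congruence1970, §2.6 Cor. 3] by the tree
theorem `SL2Rel.relG_top_span_le_relE_of_morris_of_serre`. -/
theorem relGLeRelE_of_morris_of_serre (hL : Morris2007.thm61_2_elementary_boundedlyGenerates)
    (hC : SerreSL2Congruence1970_congruenceSubgroupProperty_away) {p N : ℕ} (hp : p.Prime) (hN : 0 < N) :
    RelGLeRelE p N :=
  SL2Rel.relG_top_span_le_relE_of_morris_of_serre hL hC hp.two_le hN.ne'

/-- **THEOREM B modulo its two printed inputs, BY NAME**: (L) Morris 2007 Thm. 6.1 (2) ∧ (C) Serre 1970 §2.6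
Cor. 3 (both cite-only Literature facts at `ℤ[1/m]`) ⟹ `ConjSpanGenAll`, i.e. for every `N ≥ 1` and every prime
`p ∤ N`, `Γ_H(N) ⊆ ⟨good, finite-order, trace-±2 elements⟩ · [Γ₀(N), Γ₀(N)]` — equivalently (Manin 1972
Prop. 1.4) the closed `p`-power cyclotomic winding classes `{0 → a/pⁿ}` span `pr Γ_H(N) ⊆ H₁(X₀(N); ℤ)`. -/
theorem conjSpanGenAll_of_morris_of_serre (hL : Morris2007.thm61_2_elementary_boundedlyGenerates)
    (hC : SerreSL2Congruence1970_congruenceSubgroupProperty_away) : ConjSpanGenAll :=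
  conjSpanGenAll_of_relGLeRelE_all fun _ _ hp hN _ => relGLeRelE_of_morris_of_serre hL hC hp hN

/-- Single level: (L) ∧ (C) ⟹ `ConjSpanGen N p` for `p` prime, `p ∤ N`. -/
theorem conjSpanGen_of_morris_of_serre (hL : Morris2007.thm61_2_elementary_boundedlyGenerates)
    (hC : SerreSL2Congruence1970_congruenceSubgroupProperty_away) {N p : ℕ} (hp : p.Prime) (hpN : ¬ p ∣ N) :
    ConjSpanGen N p :=
  conjSpanGenAll_of_morris_of_serre hL hC N p hp hpN

/-- Single level, prime-to-`p` form: (L) ∧ (C) ⟹ `EisSpanGen N p` (carrier `eisSpanGen_of_conjSpanGen`). -/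
theorem eisSpanGen_of_morris_of_serre (hL : Morris2007.thm61_2_elementary_boundedlyGenerates)
    (hC : SerreSL2Congruence1970_congruenceSubgroupProperty_away) {N p : ℕ} (hp : p.Prime) (hpN : ¬ p ∣ N) :
    EisSpanGen N p :=
  eisSpanGen_of_conjSpanGen hp.ne_one (conjSpanGen_of_morris_of_serre hL hC hp hpN)

/-- Single level, mod-`p` form: (L) ∧ (C) ⟹ `EisSpanModGen N p` — the hypothesis `hspan` of the VS-B bridge
`Theorems/PrintX8VerticalStevensBridge.lean` and of the referee's `refMu_of_eisSpanModGen` (at `p = 3`: every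
level `N` with `3 ∤ N`). -/
theorem eisSpanModGen_of_morris_of_serre (hL : Morris2007.thm61_2_elementary_boundedlyGenerates)
    (hC : SerreSL2Congruence1970_congruenceSubgroupProperty_away) {N p : ℕ} (hp : p.Prime) (hpN : ¬ p ∣ N) :
    EisSpanModGen N p :=
  eisSpanModGen_of_conjSpanGen (conjSpanGen_of_morris_of_serre hL hC hp hpN)

end FromMorrisSerre

end

end Summit.BirchSwinnertonDyer.BirchSwinnertonDyer.Theorems.ConjSpanGenAllLevels
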